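import Literature.AlgebraicGeometry.Frobenioids.ArchimedeanFrobenioids
import Mathlib.Analysis.SpecialFunctions.Pow.Real
import HarnessLib

/-!
# Frobenioids II, Example 3.3 (i) / [AbsTopIII] Rmk 5.8.1 (i): the DILATIONS to which the mono-analytic monoid `(𝒪^▷_ℂ, (0,1])` is
# «subject» lift to the archimedean Frobenioid — for every `μ > 0`, `D_μ : z ↦ z·|z|^{μ-1}` induces a self-equivalence of `C₀`

S. Mochizuki, *The geometry of Frobenioids II*, Kyushu J. Math. **62** (2008) 401–460, §3, Def. 3.1 (ii)–(iii) pp. 23–24 (the canonical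
decomposition `𝒪_K^× × ord(K^×) ≅ K^×`, angular regions `A = B × (0, λ]`) and Example 3.3 (i) p. 27 (the category `C₀`: objects
`(Spec K, V_K, A_K)`, morphisms `(Base(φ), deg_Fr(φ), c)` with (c) «an isomorphism of `L`-vector spaces `V_L^{⊗d} ⥲ V_K|_L` that maps `A_L^{⊗d}` into
`A_K|_L`») [cite: MochizukiFrdII2008, Ex 3.3 (i) p.27];
S. Mochizuki, *Topics in absolute anabelian geometry III*, Rmk 5.8.1 (i) p. 142 («the object of 𝕋𝕄⊢ consisting of an isomorph of the topological
monoid `𝒪^▷_ℂ` equipped with the submonoid corresponding to `𝒪^▷_ℂ ∩ ℝ_{>0}`, which is non-rigid, in the sense that it is subject to dilations»)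
[cite: MochizukiAbsTopIII2015, Remark 5.8.1 p.142].  Consumed by [IUTchI] Ex 3.4 (ii) / Cor 5.3 (iii) at `v ∈ 𝕍^arc`
(the `⊢`-triple `ℱ⊢_v = (𝒞⊢_v, 𝒟⊢_v, τ⊢_v)`, «`Isom(¹𝔉⊢, ²𝔉⊢) → Isom(¹𝔇⊢, ²𝔇⊢)` […] is surjective»): an automorphism of the split topological
monoid `(𝒪^▷_ℂ, (0,1])` that is a dilation on `(0, 1]` DOES lift to the archimedean Frobenioid.

## What this file builds (abc-iut cell, row R83 «COR53III-ARCH-DASH-SLOT» tier (T2-i), abc-iut-L5-t16; generic [FrdII] §3 plumbing over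
## abc-iut-L1-t6's `ArchimedeanData` / `ArchimedeanBaseCategory` / `ArchimedeanFrobenioids` — no IUT vocabulary)

* §1 `ArchFrd.PosReal.rpowEquiv μ : ℝ_{>0} ≃* ℝ_{>0}`, `x ↦ x^μ` (`μ > 0`; inverse `x ↦ x^{1/μ}`), monotone both ways;
* §2 `ArchFrd.dilate μ : ℂ^× ≃* ℂ^×`, `u·r ↦ u·r^μ` through abc-iut-L1-t6's polar decomposition `unitDecomposition ℂ` — `unitPart` preserved,
  `absHom` raised to the `μ`-th power; commutes with complex conjugation (`dilate_star`, `dilate_galAct`), preserves the scalars `K^× ⊆ ℂ^×` of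
  both objects of `D₀` (`dilate_mem_scalars`), `(dilate μ).symm = dilate μ⁻¹`;
* §3 on angular regions: `AngularRegion.dilateTip μ A = (B, λ^μ)` and **`image_dilate_carrier : dilate μ '' A = (A.dilateTip μ)`** (as subsets of
  `ℂ^×`), `image_dilate_pullRegion`;
* §4 **the dilation functor `C0.dilateFunctor μ : C₀ ⥤ C₀`**: objects `(K, (B, λ)) ↦ (K, (B, λ^μ))`, morphisms `(f, d, c) ↦ (f, d, D_μ c)` — well
  defined because `D_μ (c · A^d) = D_μ c · (D_μ A)^d ⊆ D_μ (A'|_f) = (D_μ A')|_f`; functoriality from `D_μ ∘ ι_f = ι_f ∘ D_μ` and multiplicativity;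
  `dilateFunctor_comp_baseFunctor` (over the IDENTITY of `D₀`); it is FULL, FAITHFUL and ESSENTIALLY SURJECTIVE (`dilateObj μ (dilateObj μ⁻¹ Y) = Y`),
  hence an EQUIVALENCE (`dilateFunctor_isEquivalence`), OURS: print records only that the mono-analytic monoid is «subject to dilations».
Binders: `μ : ℝ_{>0}`; 0 instance · 0 notation · no `Prop` fact.  Classical; nothing here concerns [IUTchIII] Cor. 3.12; no side is taken on any
disputed claim.  The lift to `C = C₀ ×_{D₀} D` (in particular [IUTchI]'s `ArchFrd.Cpt`) and the induced `𝕋𝕄⊢`-automorphism of `𝒪^▷(std t)` are the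
sequel (T2-ii).
-/

noncomputable section

namespace Literature.AlgebraicGeometry.Frobenioids

open CategoryTheory
open scoped Pointwise

namespace ArchFrd

/-! ### §1. `x ↦ x^μ` on `ℝ_{>0}` -/

namespace PosReal

/-- **`x ↦ x^μ`** (`μ > 0`), a multiplicative automorphism of `ℝ_{>0}` with inverse `x ↦ x^{μ⁻¹}` (the dilations of `ord(K^×) ≅ ℝ_{>0}`).
[cite: MochizukiFrdII2008, Def 3.1 (ii) pp.23-24] -/
def rpowEquiv (μ : PosReal) : PosReal ≃* PosReal where
  toFun x := ⟨(x : ℝ) ^ (μ : ℝ), Real.rpow_pos_of_pos x.2 _⟩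
  invFun x := ⟨(x : ℝ) ^ (μ : ℝ)⁻¹, Real.rpow_pos_of_pos x.2 _⟩
  left_inv x := Subtype.ext (by
    change ((x : ℝ) ^ (μ : ℝ)) ^ (μ : ℝ)⁻¹ = (x : ℝ)
    rw [← Real.rpow_mul x.2.le, mul_inv_cancel₀ μ.2.ne', Real.rpow_one])
  right_inv x := Subtype.ext (by
    change ((x : ℝ) ^ (μ : ℝ)⁻¹) ^ (μ : ℝ) = (x : ℝ)
    rw [← Real.rpow_mul x.2.le, inv_mul_cancel₀ μ.2.ne', Real.rpow_one])
  map_mul' x y := Subtype.ext (by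
    change ((x : ℝ) * (y : ℝ)) ^ (μ : ℝ) = (x : ℝ) ^ (μ : ℝ) * (y : ℝ) ^ (μ : ℝ)
    exact Real.mul_rpow x.2.le y.2.le)

/-- The value of `rpowEquiv`. [cite: MochizukiFrdII2008, Def 3.1 (ii) pp.23-24] -/
@[simp] theorem coe_rpowEquiv (μ x : PosReal) : ((rpowEquiv μ x : PosReal) : ℝ) = (x : ℝ) ^ (μ : ℝ) := rfl

/-- `(rpowEquiv μ)⁻¹ = rpowEquiv μ⁻¹`. [cite: MochizukiFrdII2008, Def 3.1 (ii) pp.23-24] -/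
theorem rpowEquiv_symm (μ : PosReal) : (rpowEquiv μ).symm = rpowEquiv μ⁻¹ := by
  ext x; rfl

/-- `x ↦ x^μ` preserves and reflects `≤` on `ℝ_{>0}`. [cite: MochizukiFrdII2008, Def 3.1 (ii) pp.23-24] -/
theorem rpowEquiv_le_rpowEquiv_iff (μ x y : PosReal) : rpowEquiv μ x ≤ rpowEquiv μ y ↔ x ≤ y := by
  change (x : ℝ) ^ (μ : ℝ) ≤ (y : ℝ) ^ (μ : ℝ) ↔ (x : ℝ) ≤ (y : ℝ)
  exact Real.rpow_le_rpow_iff x.2.le y.2.le μ.2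

end PosReal

/-! ### §2. The dilation `D_μ` of `ℂ^×` -/

/-- **The dilation `D_μ : ℂ^× ⥲ ℂ^×`, `u · r ↦ u · r^μ`** (`u ∈ 𝒪_ℂ^× = S¹`, `r ∈ ℝ_{>0}`; i.e. `z ↦ z · |z|^{μ-1}`): conjugation of `x ↦ x^μ` on the
`ord`-factor by abc-iut-L1-t6's canonical decomposition `𝒪_ℂ^× × ℝ_{>0} ≅ ℂ^×` ([FrdII] Def 3.1 (ii)); a multiplicative automorphism which is NOT a
field automorphism unless `μ = 1` — the dilations of [AbsTopIII] Rmk 5.8.1 (i). [cite: MochizukiFrdII2008, Def 3.1 (ii) pp.23-24] -/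
def dilate (μ : PosReal) : ℂˣ ≃* ℂˣ :=
  (unitDecomposition ℂ).symm.trans (((MulEquiv.refl (normOneSubgroup ℂ)).prodCongr (PosReal.rpowEquiv μ)).trans (unitDecomposition ℂ))

/-- `D_μ u = unitPart(u) · (|u|^μ)`. [cite: MochizukiFrdII2008, Def 3.1 (ii) pp.23-24] -/
theorem dilate_apply (μ : PosReal) (u : ℂˣ) :
    dilate μ u = (unitPart ℂ u : ℂˣ) * ofPosReal ℂ (PosReal.rpowEquiv μ (absHom ℂ u)) := rfl

/-- The polar coordinates of `D_μ u`: `(unitPart u, |u|^μ)`. [cite: MochizukiFrdII2008, Def 3.1 (ii) pp.23-24] -/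
theorem unitDecomposition_symm_dilate (μ : PosReal) (u : ℂˣ) :
    (unitDecomposition ℂ).symm (dilate μ u) = (unitPart ℂ u, PosReal.rpowEquiv μ (absHom ℂ u)) := by
  rw [dilate, MulEquiv.trans_apply, MulEquiv.trans_apply, MulEquiv.symm_apply_apply]
  rfl

/-- `D_μ` preserves the angular part: `unitPart (D_μ u) = unitPart u`. [cite: MochizukiFrdII2008, Def 3.1 (ii) pp.23-24] -/
theorem unitPart_dilate (μ : PosReal) (u : ℂˣ) : unitPart ℂ (dilate μ u) = unitPart ℂ u :=
  congrArg Prod.fst (unitDecomposition_symm_dilate μ u)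

/-- `D_μ` raises the modulus to the `μ`-th power: `|D_μ u| = |u|^μ`. [cite: MochizukiFrdII2008, Def 3.1 (ii) pp.23-24] -/
theorem absHom_dilate (μ : PosReal) (u : ℂˣ) : absHom ℂ (dilate μ u) = PosReal.rpowEquiv μ (absHom ℂ u) :=
  congrArg Prod.snd (unitDecomposition_symm_dilate μ u)

/-- `(D_μ)⁻¹ = D_{μ⁻¹}`. [cite: MochizukiFrdII2008, Def 3.1 (ii) pp.23-24] -/
theorem dilate_symm (μ : PosReal) : (dilate μ).symm = dilate μ⁻¹ := by
  ext u; rfl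

/-- `D_μ⁻¹ ∘ D_μ = id` on elements. [cite: MochizukiFrdII2008, Def 3.1 (ii) pp.23-24] -/
theorem dilate_inv_dilate (μ : PosReal) (u : ℂˣ) : dilate μ⁻¹ (dilate μ u) = u := by
  rw [← dilate_symm, MulEquiv.symm_apply_apply]

/-- `D_μ ∘ D_μ⁻¹ = id` on elements. [cite: MochizukiFrdII2008, Def 3.1 (ii) pp.23-24] -/
theorem dilate_dilate_inv (μ : PosReal) (u : ℂˣ) : dilate μ (dilate μ⁻¹ u) = u := by
  rw [← dilate_symm, MulEquiv.apply_symm_apply]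

/-- Positive reals are fixed by complex conjugation in `ℂ^×`. [cite: MochizukiFrdII2008, Def 3.1 (ii) pp.23-24] -/
theorem star_ofPosReal (x : PosReal) : star (ofPosReal ℂ x) = ofPosReal ℂ x :=
  Units.ext (by rw [Units.coe_star, coe_ofPosReal]; exact Complex.conj_ofReal _)

/-- Complex conjugation preserves the modulus. [cite: MochizukiFrdII2008, Def 3.1 (ii) pp.23-24] -/
theorem absHom_star (u : ℂˣ) : absHom ℂ (star u) = absHom ℂ u :=
  Subtype.ext (by
    change ‖((star u : ℂˣ) : ℂ)‖ = ‖(u : ℂ)‖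
    rw [Units.coe_star]
    exact Complex.norm_conj (u : ℂ))

/-- Complex conjugation commutes with the angular part: `unitPart (ū) = conj (unitPart u)` in `ℂ^×`. [cite: MochizukiFrdII2008, Def 3.1 (ii) pp.23-24] -/
theorem coe_unitPart_star (u : ℂˣ) : ((unitPart ℂ (star u) : normOneSubgroup ℂ) : ℂˣ) = star ((unitPart ℂ u : normOneSubgroup ℂ) : ℂˣ) := by
  change star u * (ofPosReal ℂ (absHom ℂ (star u)))⁻¹ = star (u * (ofPosReal ℂ (absHom ℂ u))⁻¹)
  rw [absHom_star, star_mul, star_inv, star_ofPosReal, mul_comm]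

/-- **`D_μ` commutes with complex conjugation**: `D_μ (ū) = conj (D_μ u)`. [cite: MochizukiFrdII2008, Def 3.1 (ii) pp.23-24] -/
theorem dilate_star (μ : PosReal) (u : ℂˣ) : dilate μ (star u) = star (dilate μ u) := by
  rw [dilate_apply, dilate_apply, coe_unitPart_star, absHom_star, star_mul, star_ofPosReal, mul_comm]

/-- **`D_μ` commutes with the action of `D₀`'s arrows** (Galois twists `ι_f ∈ {id, conj}`): `D_μ (ι_f u) = ι_f (D_μ u)`.
[cite: MochizukiFrdII2008, Ex 3.3 (i) p.27] -/
theorem dilate_galAct (μ : PosReal) (σ : Bool) (u : ℂˣ) : dilate μ (D0.galAct σ u) = D0.galAct σ (dilate μ u) := by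
  cases σ
  · rw [D0.galAct_false, D0.galAct_false]
  · rw [D0.galAct_true, D0.galAct_true, dilate_star]

/-- `D_μ u` is `u` times a (positive) REAL scalar: `D_μ u = u · (|u|⁻¹ · |u|^μ)`. [cite: MochizukiFrdII2008, Def 3.1 (ii) pp.23-24] -/
theorem dilate_eq_mul_ofPosReal (μ : PosReal) (u : ℂˣ) :
    dilate μ u = u * ofPosReal ℂ ((absHom ℂ u)⁻¹ * PosReal.rpowEquiv μ (absHom ℂ u)) := by
  rw [dilate_apply, map_mul, map_inv, ← mul_assoc]
  rfl

/-- **`D_μ` preserves the scalars `K^× ⊆ ℂ^×` of both objects of `D₀`** (`ℝ^×` is carried to `ℝ^×`: a real times a positive real).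
[cite: MochizukiFrdII2008, Def 3.1 (ii) p.23] -/
theorem dilate_mem_scalars (μ : PosReal) {K : D0} {u : ℂˣ} (hu : u ∈ D0.scalars K) : dilate μ u ∈ D0.scalars K := by
  cases K with
  | complex => exact Subgroup.mem_top _
  | real =>
    rw [dilate_eq_mul_ofPosReal]
    refine Subgroup.mul_mem _ hu ⟨Units.mk0 _ ((absHom ℂ u)⁻¹ * PosReal.rpowEquiv μ (absHom ℂ u)).2.ne', Units.ext ?_⟩
    rw [coe_ofPosReal]
    rfl

/-! ### §3. Dilating angular regions: `(B, λ) ↦ (B, λ^μ)` -/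

namespace AngularRegion

/-- The dilated angular region `(B, λ^μ)` (same angular part, tip raised to the `μ`-th power). [cite: MochizukiFrdII2008, Def 3.1 (iii) p.24] -/
def dilateTip (μ : PosReal) (A : AngularRegion ℂ) : AngularRegion ℂ where
  dir := A.dir
  tip := PosReal.rpowEquiv μ A.tip
  isOpen_dir := A.isOpen_dir
  isConnected_inter := A.isConnected_inter

/-- `(B, λ^μ)` has angular part `B`. [cite: MochizukiFrdII2008, Def 3.1 (iii) p.24] -/
@[simp] theorem dilateTip_dir (μ : PosReal) (A : AngularRegion ℂ) : (A.dilateTip μ).dir = A.dir := rfl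

/-- `(B, λ^μ)` has tip `λ^μ`. [cite: MochizukiFrdII2008, Def 3.1 (iii) p.24] -/
@[simp] theorem dilateTip_tip (μ : PosReal) (A : AngularRegion ℂ) : (A.dilateTip μ).tip = PosReal.rpowEquiv μ A.tip := rfl

/-- Dilating twice with inverse exponents returns the region. [cite: MochizukiFrdII2008, Def 3.1 (iii) p.24] -/
theorem dilateTip_inv_dilateTip (μ : PosReal) (A : AngularRegion ℂ) : (A.dilateTip μ⁻¹).dilateTip μ = A := by
  cases A with
  | mk dir tip ho hc =>
    simp only [dilateTip, AngularRegion.mk.injEq, true_and]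
    rw [← PosReal.rpowEquiv_symm, MulEquiv.apply_symm_apply]

/-- Dilating with `μ` then `μ⁻¹` returns the region. [cite: MochizukiFrdII2008, Def 3.1 (iii) p.24] -/
theorem dilateTip_dilateTip_inv (μ : PosReal) (A : AngularRegion ℂ) : (A.dilateTip μ).dilateTip μ⁻¹ = A := by
  simpa only [inv_inv] using dilateTip_inv_dilateTip μ⁻¹ A

/-- `(B, λ^μ)` is isotropic iff `(B, λ)` is (same angular part). [cite: MochizukiFrdII2008, Ex 3.3 (i) p.27] -/
theorem isIsotropic_dilateTip_iff (μ : PosReal) (A : AngularRegion ℂ) : (A.dilateTip μ).IsIsotropic ↔ A.IsIsotropic := Iff.rfl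

/-- **`u ∈ A ↔ D_μ u ∈ (B, λ^μ)`**: the angular part is unchanged and `|u| ≤ λ ↔ |u|^μ ≤ λ^μ`. [cite: MochizukiFrdII2008, Def 3.1 (iii) p.24] -/
theorem dilate_mem_carrier_iff (μ : PosReal) (A : AngularRegion ℂ) (u : ℂˣ) : dilate μ u ∈ (A.dilateTip μ).carrier ↔ u ∈ A.carrier := by
  change (unitPart ℂ (dilate μ u) ∈ A.dir ∧ absHom ℂ (dilate μ u) ≤ PosReal.rpowEquiv μ A.tip) ↔ (unitPart ℂ u ∈ A.dir ∧ absHom ℂ u ≤ A.tip)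
  rw [unitPart_dilate, absHom_dilate, PosReal.rpowEquiv_le_rpowEquiv_iff]

/-- **`D_μ (A) = (B, λ^μ)`** as subsets of `ℂ^×`. [cite: MochizukiFrdII2008, Def 3.1 (iii) p.24] -/
theorem image_dilate_carrier (μ : PosReal) (A : AngularRegion ℂ) : dilate μ '' A.carrier = (A.dilateTip μ).carrier := by
  ext u
  constructor
  · rintro ⟨v, hv, rfl⟩
    exact (dilate_mem_carrier_iff μ A v).mpr hv
  · intro hu
    refine ⟨dilate μ⁻¹ u, ?_, dilate_dilate_inv μ u⟩
    rw [← dilate_mem_carrier_iff μ A, dilate_dilate_inv]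
    exact hu

/-- `D_μ⁻¹ (B, λ^μ) = (B, λ)` as subsets of `ℂ^×`. [cite: MochizukiFrdII2008, Def 3.1 (iii) p.24] -/
theorem image_dilate_inv_carrier_dilateTip (μ : PosReal) (A : AngularRegion ℂ) : dilate μ⁻¹ '' (A.dilateTip μ).carrier = A.carrier := by
  rw [← image_dilate_carrier μ A, Set.image_image]
  conv_rhs => rw [← Set.image_id A.carrier]
  exact Set.image_congr' fun u => dilate_inv_dilate μ u

end AngularRegion

/-! ### §4. The dilation functor `C₀ ⥤ C₀` and its equivalence -/

namespace C0

/-- **Dilated objects**: `(K, (B, λ)) ↦ (K, (B, λ^μ))`. [cite: MochizukiFrdII2008, Ex 3.3 (i) p.27] -/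
def dilateObj (μ : PosReal) (X : C0) : C0 where
  base := X.base
  region := X.region.dilateTip μ
  isIsotropic_of_isReal h := (AngularRegion.isIsotropic_dilateTip_iff μ X.region).mpr (X.isIsotropic_of_isReal h)

/-- The base of a dilated object is unchanged. [cite: MochizukiFrdII2008, Ex 3.3 (i) p.27] -/
@[simp] theorem dilateObj_base (μ : PosReal) (X : C0) : (dilateObj μ X).base = X.base := rfl

/-- The region of a dilated object. [cite: MochizukiFrdII2008, Ex 3.3 (i) p.27] -/
@[simp] theorem dilateObj_region (μ : PosReal) (X : C0) : (dilateObj μ X).region = X.region.dilateTip μ := rfl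

/-- `dilateObj μ (dilateObj μ⁻¹ Y) = Y`. [cite: MochizukiFrdII2008, Ex 3.3 (i) p.27] -/
theorem dilateObj_dilateObj_inv (μ : PosReal) (Y : C0) : dilateObj μ (dilateObj μ⁻¹ Y) = Y := by
  cases Y with
  | mk base region h =>
    simp only [dilateObj, AngularRegion.dilateTip_inv_dilateTip]

/-- **`D_μ` of a pulled-back region is the pull-back of the dilated region** (`D_μ ∘ ι_f = ι_f ∘ D_μ`). [cite: MochizukiFrdII2008, Ex 3.3 (i) p.27] -/
theorem image_dilate_pullRegion (μ : PosReal) (Y : C0) {L : D0} (f : L ⟶ Y.base) :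
    dilate μ '' pullRegion Y f = pullRegion (dilateObj μ Y) f := by
  change dilate μ '' (f.act '' Y.region.carrier) = f.act '' (Y.region.dilateTip μ).carrier
  rw [← AngularRegion.image_dilate_carrier, Set.image_image, Set.image_image]
  refine Set.image_congr' fun u => ?_
  exact dilate_galAct μ _ u

/-- `D_μ⁻¹` of the pull-back of a dilated region is the original pull-back. [cite: MochizukiFrdII2008, Ex 3.3 (i) p.27] -/
theorem image_dilate_inv_pullRegion_dilateObj (μ : PosReal) (Y : C0) {L : D0} (f : L ⟶ Y.base) :
    dilate μ⁻¹ '' pullRegion (dilateObj μ Y) f = pullRegion Y f := by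
  rw [← image_dilate_pullRegion μ Y f, Set.image_image]
  conv_rhs => rw [← Set.image_id (pullRegion Y f)]
  exact Set.image_congr' fun u => dilate_inv_dilate μ u

/-- `dilateObj μ⁻¹ (dilateObj μ Y) = Y`. [cite: MochizukiFrdII2008, Ex 3.3 (i) p.27] -/
theorem dilateObj_inv_dilateObj (μ : PosReal) (Y : C0) : dilateObj μ⁻¹ (dilateObj μ Y) = Y := by
  simpa only [inv_inv] using dilateObj_dilateObj_inv μ⁻¹ Y

/-- **Dilated morphisms**: `(f, d, c) ↦ (f, d, D_μ c)` — `D_μ c · (D_μ A_L)^d = D_μ (c · A_L^d) ⊆ D_μ (A_K|_f) = (D_μ A_K)|_f`.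
[cite: MochizukiFrdII2008, Ex 3.3 (i) p.27] -/
def dilateHom (μ : PosReal) {X Y : C0} (φ : X ⟶ Y) : dilateObj μ X ⟶ dilateObj μ Y where
  base := (show X.base ⟶ Y.base from Base φ)
  degFr := degFr φ
  scalar := dilate μ (scalar φ)
  scalar_mem := dilate_mem_scalars μ (Hom.scalar_mem (show Hom X Y from φ))
  mapsTo := by
    rw [dilateObj_region, ← AngularRegion.image_dilate_carrier, ← Set.image_pow, ← Set.image_smul_distrib, ← image_dilate_pullRegion]
    exact Set.image_mono (Hom.mapsTo (show Hom X Y from φ))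

/-- The scalar of a dilated morphism. [cite: MochizukiFrdII2008, Ex 3.3 (i) p.27] -/
@[simp] theorem scalar_dilateHom (μ : PosReal) {X Y : C0} (φ : X ⟶ Y) : scalar (dilateHom μ φ) = dilate μ (scalar φ) := rfl

/-- **THE DILATION FUNCTOR `C₀ ⥤ C₀`** (identity on bases and Frobenius degrees, `D_μ` on scalars; functorial because `D_μ` is multiplicative and
commutes with the Galois twists `ι_f` in the composition law `c_{φ∘ψ} = ι_{Base ψ}(c_φ) · c_ψ^{d_φ}`). [cite: MochizukiFrdII2008, Ex 3.3 (i) p.27] -/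
def dilateFunctor (μ : PosReal) : C0 ⥤ C0 where
  obj := dilateObj μ
  map := dilateHom μ
  map_id X := hom_ext rfl rfl (by
    change dilate μ 1 = 1
    exact map_one _)
  map_comp ψ φ := hom_ext rfl rfl (by
    change dilate μ ((Base ψ).act (scalar φ) * scalar ψ ^ (degFr φ : ℕ)) = (Base ψ).act (dilate μ (scalar φ)) * dilate μ (scalar ψ) ^ (degFr φ : ℕ)
    rw [map_mul, map_pow, D0.Hom.act, dilate_galAct])

/-- The dilation functor lies over the IDENTITY of the base `D₀`. [cite: MochizukiFrdII2008, Ex 3.3 (i) p.27] -/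
theorem dilateFunctor_comp_baseFunctor (μ : PosReal) : dilateFunctor μ ⋙ baseFunctor = baseFunctor := rfl

/-- The dilation functor is FAITHFUL (`D_μ` is injective on scalars). [cite: MochizukiFrdII2008, Ex 3.3 (i) p.27] -/
theorem dilateFunctor_faithful (μ : PosReal) : (dilateFunctor μ).Faithful where
  map_injective {X Y} φ ψ h := by
    have hb : Base ((dilateFunctor μ).map φ) = Base ((dilateFunctor μ).map ψ) := congrArg Base h
    have hd : degFr ((dilateFunctor μ).map φ) = degFr ((dilateFunctor μ).map ψ) := congrArg degFr h
    have hs : scalar ((dilateFunctor μ).map φ) = scalar ((dilateFunctor μ).map ψ) := congrArg scalar h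
    exact hom_ext hb hd ((dilate μ).injective hs)

/-- The dilation functor is FULL (a morphism between dilated objects with scalar `c` comes from the one with scalar `D_μ⁻¹ c`, whose
inclusion condition is the given one pulled back along `D_μ⁻¹`). [cite: MochizukiFrdII2008, Ex 3.3 (i) p.27] -/
theorem dilateFunctor_full (μ : PosReal) : (dilateFunctor μ).Full where
  map_surjective {X Y} χ := by
    have h := Set.image_mono (f := (dilate μ⁻¹ : ℂˣ → ℂˣ)) (Hom.mapsTo (show Hom (dilateObj μ X) (dilateObj μ Y) from χ))
    rw [Set.image_smul_distrib, Set.image_pow, dilateObj_region, AngularRegion.image_dilate_inv_carrier_dilateTip,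
      image_dilate_inv_pullRegion_dilateObj] at h
    refine ⟨⟨(show X.base ⟶ Y.base from @Hom.base (dilateObj μ X) (dilateObj μ Y) χ), degFr χ, dilate μ⁻¹ (scalar χ), dilate_mem_scalars μ⁻¹ (Hom.scalar_mem (show Hom (dilateObj μ X) (dilateObj μ Y) from χ)), h⟩, ?_⟩
    exact hom_ext rfl rfl (by
      change dilate μ (dilate μ⁻¹ (scalar χ)) = scalar χ
      exact dilate_dilate_inv μ _)

/-- The dilation functor is ESSENTIALLY SURJECTIVE (`Y = dilateObj μ (dilateObj μ⁻¹ Y)` on the nose). [cite: MochizukiFrdII2008, Ex 3.3 (i) p.27] -/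
theorem dilateFunctor_essSurj (μ : PosReal) : (dilateFunctor μ).EssSurj where
  mem_essImage Y := ⟨dilateObj μ⁻¹ Y, ⟨eqToIso (show (dilateFunctor μ).obj (dilateObj μ⁻¹ Y) = Y from dilateObj_dilateObj_inv μ Y)⟩⟩

/-- **THE DILATION FUNCTOR IS AN EQUIVALENCE `C₀ ≌ C₀`** — for EVERY `μ > 0`: the archimedean Frobenioid `C₀` of [FrdII] Ex 3.3 admits the
self-equivalences “`z ↦ z|z|^{μ-1}` on scalars, `λ ↦ λ^μ` on tips” over the identity of `D₀` (OURS; print: the mono-analytic monoid is «non-rigid, in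
the sense that it is subject to dilations», [AbsTopIII] Rmk 5.8.1 (i) p. 142). [cite: MochizukiFrdII2008, Ex 3.3 (i) p.27] -/
theorem dilateFunctor_isEquivalence (μ : PosReal) : (dilateFunctor μ).IsEquivalence :=
  haveI := dilateFunctor_faithful μ
  haveI := dilateFunctor_full μ
  haveI := dilateFunctor_essSurj μ
  { }

end C0

end ArchFrd

end Literature.AlgebraicGeometry.Frobenioids

end
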